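import Mathlib

/-!
# Efron–Stein (tensorisation of the variance) on a finite product space, counting form

For `f : (Fin d → C) → ℝ` on the uniform product space (`C` a nonempty finite type):
`#C · ∑_x (f x - μ)² ≤ ½ ∑_i ∑_x ∑_c (f x - f (x[i ↦ c]))²`, `μ` the mean of `f`
(`es_efronStein`). Equivalently `Var f ≤ ∑_i E Var_i f`. Proof by induction on `d` through
`Fin.consEquiv`: law of total variance in the first coordinate, the induction hypothesis on the fibres,
and "variance of an average ≤ average of the variances" (Cauchy–Schwarz) for the first coordinate.
Used for bounded-difference functionals of random `k`-SAT instances (e.g. MAX-SAT, clause counts of local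
rules), where it gives `Var = O(m)` and hence Chebyshev-level typical validity — the input format of the
engine `engine_count` of line `Sketch` (crux stmt-PneNP-2463).
-/

set_option linter.dupNamespace false -- `Summit.PneNP.PneNP.…`: summit = sub-problem (D-0017)

namespace Summit.PneNP.PneNP.Cruxes.SolvableImpliesStableSection.Sketch

open Finset
open scoped Classical

/-- Sum of squared deviations from the mean is at most the sum of squared deviations from any constant:
`∑ (a i - μ)² ≤ ∑ (a i - t)²` with `μ = (∑ a i)/#s`. -/
theorem es_sq_dev_mean_le {ι : Type*} (s : Finset ι) (a : ι → ℝ) (t : ℝ) (hs : s.Nonempty) :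
    ∑ i ∈ s, (a i - (∑ j ∈ s, a j) / s.card) ^ 2 ≤ ∑ i ∈ s, (a i - t) ^ 2 := by
  have hcard : (0 : ℝ) < s.card := by exact_mod_cast hs.card_pos
  set μ : ℝ := (∑ j ∈ s, a j) / s.card with hμ
  have hsum : ∑ i ∈ s, a i = μ * s.card := by rw [hμ]; field_simp
  have key : ∑ i ∈ s, (a i - t) ^ 2 = ∑ i ∈ s, (a i - μ) ^ 2 + s.card * (μ - t) ^ 2 := by
    have h1 : ∀ i, (a i - t) ^ 2 = (a i - μ) ^ 2 + 2 * (μ - t) * (a i - μ) + (μ - t) ^ 2 := by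
      intro i; ring
    simp only [h1, Finset.sum_add_distrib, ← Finset.mul_sum, Finset.sum_sub_distrib, Finset.sum_const,
      nsmul_eq_mul, hsum]
    ring
  rw [key]
  nlinarith [sq_nonneg (μ - t)]

/-- **Efron–Stein, counting form.** For `f : (Fin d → C) → ℝ` (`C` nonempty finite),
`#C · ∑_x (f x - μ)² ≤ ½ ∑_i ∑_x ∑_c (f x - f(x[i ↦ c]))²` where `μ = (∑_x f x) / #(Fin d → C)`. -/
theorem es_efronStein {C : Type*} [Fintype C] [DecidableEq C] [Nonempty C] :
    ∀ (d : ℕ) (f : (Fin d → C) → ℝ),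
      (Fintype.card C : ℝ) * ∑ x : Fin d → C, (f x - (∑ y : Fin d → C, f y) / Fintype.card (Fin d → C)) ^ 2
        ≤ (1 / 2 : ℝ) * ∑ i : Fin d, ∑ x : Fin d → C, ∑ c : C, (f x - f (Function.update x i c)) ^ 2 := by
  intro d
  induction d with
  | zero =>
    intro f
    -- a single point: the left side vanishes
    have h1 : ∀ x : Fin 0 → C, f x - (∑ y : Fin 0 → C, f y) / Fintype.card (Fin 0 → C) = 0 := by
      intro x
      have hx : ∀ y : Fin 0 → C, y = x := fun y => funext fun i => Fin.elim0 i
      have hs : ∑ y : Fin 0 → C, f y = f x := by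
        rw [Finset.sum_eq_single x (fun y _ hy => absurd (hx y) hy) (fun h => absurd (mem_univ x) h)]
      rw [hs, Fintype.card_fun, Fintype.card_fin, pow_zero, Nat.cast_one, div_one, sub_self]
    simp only [h1]
    simp
  | succ d ih =>
    intro f
    set N : ℝ := (Fintype.card C : ℝ) with hN
    have hN0 : 0 < N := by rw [hN]; exact_mod_cast Fintype.card_pos
    -- split `x = Fin.cons c y`
    let e := Fin.consEquiv fun _ : Fin (d + 1) => C
    have hsumE : ∀ F : (Fin (d + 1) → C) → ℝ, ∑ x, F x = ∑ c : C, ∑ y : Fin d → C, F (Fin.cons c y) := by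
      intro F
      rw [← Fintype.sum_prod_type' (fun c y => F (Fin.cons c y))]
      exact (Fintype.sum_equiv e _ _ fun p => rfl).symm
    -- fibre functions and their means
    let g : C → (Fin d → C) → ℝ := fun c y => f (Fin.cons c y)
    set M : ℝ := (Fintype.card (Fin d → C) : ℝ) with hM
    have hM0 : 0 < M := by rw [hM]; exact_mod_cast Fintype.card_pos
    let μc : C → ℝ := fun c => (∑ y, g c y) / M
    let μ : ℝ := (∑ x, f x) / Fintype.card (Fin (d + 1) → C)
    have hcardS : (Fintype.card (Fin (d + 1) → C) : ℝ) = N * M := by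
      rw [hN, hM, Fintype.card_fun, Fintype.card_fun, Fintype.card_fin, Fintype.card_fin, pow_succ]
      push_cast; ring
    have hμ : μ = (∑ c, μc c) / N := by
      have hf : ∑ x, f x = ∑ c, ∑ y, g c y := hsumE f
      simp only [μ, μc, hf, hcardS, ← Finset.sum_div]
      rw [div_div, mul_comm]
    -- (1) total variance = within + between:  ∑_x (f x - μ)² = ∑_c ∑_y (g c y - μc c)² + M ∑_c (μc c - μ)²
    have hdecomp : ∑ x, (f x - μ) ^ 2 = ∑ c, ∑ y, (g c y - μc c) ^ 2 + M * ∑ c, (μc c - μ) ^ 2 := by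
      rw [hsumE (fun x => (f x - μ) ^ 2)]
      have hc : ∀ c : C, ∑ y : Fin d → C, (f (Fin.cons c y) - μ) ^ 2
          = ∑ y, (g c y - μc c) ^ 2 + M * (μc c - μ) ^ 2 := by
        intro c
        have hsum : ∑ y : Fin d → C, g c y = μc c * M := by simp only [μc]; field_simp
        have h1 : ∀ y, (f (Fin.cons c y) - μ) ^ 2
            = (g c y - μc c) ^ 2 + 2 * (μc c - μ) * (g c y - μc c) + (μc c - μ) ^ 2 := by
          intro y; simp only [g]; ring
        simp only [h1, Finset.sum_add_distrib, ← Finset.mul_sum, Finset.sum_sub_distrib, Finset.sum_const,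
          Finset.card_univ, nsmul_eq_mul, hsum, ← hM]
        ring
      simp only [hc, Finset.sum_add_distrib, ← Finset.mul_sum]
    -- (2) within: induction hypothesis on each fibre, coordinates `i.succ`
    have hwithin : ∀ c : C, N * ∑ y, (g c y - μc c) ^ 2
        ≤ (1 / 2 : ℝ) * ∑ i : Fin d, ∑ y : Fin d → C, ∑ c' : C, (g c y - g c (Function.update y i c')) ^ 2 := by
      intro c
      have := ih (g c)
      simp only [μc, hM] at this ⊢
      exact this
    have hupdate_succ : ∀ (c : C) (y : Fin d → C) (i : Fin d) (c' : C),
        g c (Function.update y i c') = f (Function.update (Fin.cons c y) i.succ c') := by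
      intro c y i c'
      simp only [g, ← Fin.cons_update]
    -- (3) between: `M ∑_c (μc c - μ)² ≤ (1/(2N)) ∑_y ∑_c ∑_c' (g c y - g c' y)²`
    --     from "variance of the mean ≤ mean of the variances" and the pair form of the variance
    have hbetween : N * (M * ∑ c, (μc c - μ) ^ 2)
        ≤ (1 / 2 : ℝ) * ∑ y : Fin d → C, ∑ c : C, ∑ c' : C, (g c y - g c' y) ^ 2 := by
      -- pair form in coordinate 0 for each fibre point `y`: N ∑_c (g c y - m y)² = ½ ∑_c ∑_c' (g c y - g c' y)²
      have hpair : ∀ y : Fin d → C, N * ∑ c, (g c y - (∑ c', g c' y) / N) ^ 2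
          = (1 / 2 : ℝ) * ∑ c, ∑ c', (g c y - g c' y) ^ 2 := by
        intro y
        set m : ℝ := (∑ c', g c' y) / N with hm
        have hs : ∑ c, g c y = m * N := by rw [hm]; field_simp
        have h1 : ∀ c c', (g c y - g c' y) ^ 2
            = (g c y - m) ^ 2 + (g c' y - m) ^ 2 - 2 * ((g c y - m) * (g c' y - m)) := by
          intro c c'; ring
        simp only [h1, Finset.sum_add_distrib, Finset.sum_sub_distrib, Finset.sum_const, Finset.card_univ,
          nsmul_eq_mul, ← Finset.mul_sum, ← Finset.sum_mul, ← hN]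
        rw [hs]
        ring
      -- Jensen/Cauchy–Schwarz: (μc c - μ)² = (avg_y (g c y - m y))² ≤ avg_y (g c y - m y)²
      have hμc : ∀ c, μc c - μ = (∑ y, (g c y - (∑ c', g c' y) / N)) / M := by
        intro c
        rw [hμ, Finset.sum_sub_distrib, sub_div]
        simp only [μc]
        congr 1
        rw [← Finset.sum_div, ← Finset.sum_div, Finset.sum_comm, div_div, div_div, mul_comm]
      have hCS : ∀ c, M * (μc c - μ) ^ 2 ≤ ∑ y, (g c y - (∑ c', g c' y) / N) ^ 2 := by
        intro c
        rw [hμc c, div_pow, ← mul_div_assoc, div_le_iff₀ (by positivity)]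
        have h := sq_sum_le_card_mul_sum_sq (s := (univ : Finset (Fin d → C)))
          (f := fun y => g c y - (∑ c', g c' y) / N)
        rw [Finset.card_univ, ← hM] at h
        nlinarith [h]
      calc N * (M * ∑ c, (μc c - μ) ^ 2) = N * ∑ c, M * (μc c - μ) ^ 2 := by rw [Finset.mul_sum]
        _ ≤ N * ∑ c, ∑ y, (g c y - (∑ c', g c' y) / N) ^ 2 :=
            mul_le_mul_of_nonneg_left (Finset.sum_le_sum fun c _ => hCS c) hN0.le
        _ = ∑ y, N * ∑ c, (g c y - (∑ c', g c' y) / N) ^ 2 := by rw [Finset.sum_comm, Finset.mul_sum]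
        _ = ∑ y, (1 / 2 : ℝ) * ∑ c, ∑ c', (g c y - g c' y) ^ 2 := Finset.sum_congr rfl fun y _ => hpair y
        _ = _ := by rw [← Finset.mul_sum]
    -- (4) the right-hand side split by the coordinate: `i = 0` and `i = succ j`
    have hrhs : ∑ i : Fin (d + 1), ∑ x : Fin (d + 1) → C, ∑ c : C, (f x - f (Function.update x i c)) ^ 2
        = (∑ y : Fin d → C, ∑ c : C, ∑ c' : C, (g c y - g c' y) ^ 2)
          + ∑ c : C, ∑ i : Fin d, ∑ y : Fin d → C, ∑ c' : C, (g c y - g c (Function.update y i c')) ^ 2 := by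
      rw [Fin.sum_univ_succ]
      congr 1
      · rw [hsumE (fun x => ∑ c', (f x - f (Function.update x 0 c')) ^ 2), Finset.sum_comm]
        refine Finset.sum_congr rfl fun y _ => Finset.sum_congr rfl fun c _ =>
          Finset.sum_congr rfl fun c' _ => ?_
        simp only [g, Fin.update_cons_zero]
      · symm
        rw [Finset.sum_comm]
        refine Finset.sum_congr rfl fun i _ => ?_
        rw [hsumE (fun x => ∑ c', (f x - f (Function.update x i.succ c')) ^ 2)]
        refine Finset.sum_congr rfl fun c _ => Finset.sum_congr rfl fun y _ =>
          Finset.sum_congr rfl fun c' _ => ?_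
        rw [hupdate_succ]
    -- (5) assemble
    rw [hdecomp, mul_add, Finset.mul_sum, hrhs]
    have hW : ∑ c, N * ∑ y, (g c y - μc c) ^ 2 ≤ (1 / 2 : ℝ) * ∑ c, ∑ i : Fin d, ∑ y : Fin d → C, ∑ c' : C,
        (g c y - g c (Function.update y i c')) ^ 2 := by
      rw [Finset.mul_sum]
      exact Finset.sum_le_sum fun c _ => hwithin c
    linarith [hW, hbetween]

/-! ## Boost: wherever satisfiability has probability `≥ ε`, the arg-max-sat map is typically `ν`-valid

("the validity half of the transfer is free", see `Lines/Sketch.md`, anatomy of `stub_transfer`). -/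

/-- Number of clauses of `Φ` satisfied by `σ`. -/
private theorem bst_satcount_le {k m n : ℕ} (Φ : Fin m → Fin k → Fin n × Bool) (σ : Fin n → Bool) :
    ((univ : Finset (Fin m)).filter fun i => ∃ j, σ (Φ i j).1 = (Φ i j).2).card ≤ m :=
  (Finset.card_filter_le _ _).trans (by rw [Finset.card_univ, Fintype.card_fin])

/-- Changing one clause changes the number of satisfied clauses (for a fixed `σ`) by at most one. -/
private theorem bst_satcount_update {k m n : ℕ} (Φ : Fin m → Fin k → Fin n × Bool) (i₀ : Fin m)
    (cl : Fin k → Fin n × Bool) (σ : Fin n → Bool) :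
    ((univ : Finset (Fin m)).filter fun i => ∃ j, σ (Φ i j).1 = (Φ i j).2).card
      ≤ ((univ : Finset (Fin m)).filter fun i =>
          ∃ j, σ ((Function.update Φ i₀ cl) i j).1 = ((Function.update Φ i₀ cl) i j).2).card + 1 := by
  calc ((univ : Finset (Fin m)).filter fun i => ∃ j, σ (Φ i j).1 = (Φ i j).2).card
      ≤ ((((univ : Finset (Fin m)).filter fun i => ∃ j, σ (Φ i j).1 = (Φ i j).2).erase i₀).card) + 1 := by
        by_cases h : i₀ ∈ (univ : Finset (Fin m)).filter fun i => ∃ j, σ (Φ i j).1 = (Φ i j).2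
        · rw [Finset.card_erase_add_one h]
        · rw [Finset.erase_eq_of_notMem h]; exact Nat.le_succ _
    _ ≤ _ := by
        refine Nat.add_le_add_right (Finset.card_le_card fun i hi => ?_) 1
        simp only [mem_erase, mem_filter, mem_univ, true_and] at hi ⊢
        rw [Function.update_of_ne hi.1]
        exact hi.2

/-- **Boost (counting form).** If at least an `ε`-fraction of the instances with `m ≥ 2/(ε ν²)` clauses are
satisfiable, then the map `g` sending an instance to an assignment satisfying the MAXIMUM number of its clauses
violates more than `ν m` clauses on at most a `2/(ν² m)`-fraction of instances:
`(k m)·#{Φ : ¬(#violated(g Φ, Φ) ≤ ν m)} ≤ (2k/ν²)·#instances`. Proof: MAX-SAT has bounded differences `1`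
in the clauses, so Efron–Stein (`es_efronStein`) gives `∑_Φ (maxsat Φ - μ)² ≤ m·#instances/2`; satisfiable
instances have `maxsat = m`, forcing `μ ≥ m - √(m/(2ε)) ≥ m - ν m/2`; Chebyshev in counting form finishes. -/
theorem boost_typically_valid (k m n : ℕ) (ν ε : ℝ) (hν : 0 < ν) (hε : 0 < ε)
    (hm : 2 / (ε * ν ^ 2) ≤ m)
    (hsat : ε * Fintype.card (Fin m → Fin k → Fin n × Bool)
      ≤ ((univ : Finset (Fin m → Fin k → Fin n × Bool)).filter fun Φ =>
          ∃ σ : Fin n → Bool, ∀ i, ∃ j, σ (Φ i j).1 = (Φ i j).2).card) :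
    ∃ g : (Fin m → Fin k → Fin n × Bool) → (Fin n → Bool),
      ((k * m : ℕ) : ℝ) * (((univ : Finset (Fin m → Fin k → Fin n × Bool)).filter fun Φ =>
          ¬ ((((univ : Finset (Fin m)).filter fun i => ∀ j, g Φ (Φ i j).1 ≠ (Φ i j).2).card : ℝ) ≤ ν * m)).card : ℝ)
        ≤ 2 * k / ν ^ 2 * Fintype.card (Fin m → Fin k → Fin n × Bool) := by
  -- the arg-max map and the MAX-SAT functional
  have hex : ∀ Φ : Fin m → Fin k → Fin n × Bool, ∃ σ : Fin n → Bool, ∀ τ : Fin n → Bool,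
      ((univ : Finset (Fin m)).filter fun i => ∃ j, τ (Φ i j).1 = (Φ i j).2).card
        ≤ ((univ : Finset (Fin m)).filter fun i => ∃ j, σ (Φ i j).1 = (Φ i j).2).card := by
    intro Φ
    obtain ⟨σ, -, hσ⟩ := Finset.exists_max_image (univ : Finset (Fin n → Bool))
      (fun τ => ((univ : Finset (Fin m)).filter fun i => ∃ j, τ (Φ i j).1 = (Φ i j).2).card) univ_nonempty
    exact ⟨σ, fun τ => hσ τ (mem_univ τ)⟩
  choose g hg using hex
  refine ⟨g, ?_⟩
  set N : ℝ := (Fintype.card (Fin m → Fin k → Fin n × Bool) : ℝ) with hNdef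
  set f : (Fin m → Fin k → Fin n × Bool) → ℝ := fun Φ =>
    (((univ : Finset (Fin m)).filter fun i => ∃ j, g Φ (Φ i j).1 = (Φ i j).2).card : ℝ) with hfdef
  rcases Nat.eq_zero_or_pos m with hm0 | hmpos
  · -- no clauses: nothing is violated
    have : ((univ : Finset (Fin m → Fin k → Fin n × Bool)).filter fun Φ =>
        ¬ ((((univ : Finset (Fin m)).filter fun i => ∀ j, g Φ (Φ i j).1 ≠ (Φ i j).2).card : ℝ) ≤ ν * m)) = ∅ := by
      refine Finset.filter_eq_empty_iff.2 fun Φ _ => ?_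
      subst hm0
      simp
    rw [this, Finset.card_empty, Nat.cast_zero, mul_zero]
    positivity
  have hmR : (0 : ℝ) < m := by exact_mod_cast hmpos
  -- bounded differences and Efron–Stein: `∑ (f - μ)² ≤ m N / 2`
  set μ : ℝ := (∑ Φ, f Φ) / N with hμdef
  have hbd : ∀ (Φ : Fin m → Fin k → Fin n × Bool) (i : Fin m) (cl : Fin k → Fin n × Bool),
      (f Φ - f (Function.update Φ i cl)) ^ 2 ≤ 1 := by
    intro Φ i cl
    have h1 : f Φ ≤ f (Function.update Φ i cl) + 1 := by
      simp only [hfdef]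
      have := (bst_satcount_update Φ i cl (g Φ)).trans
        (Nat.add_le_add_right (hg (Function.update Φ i cl) (g Φ)) 1)
      exact_mod_cast this
    have h2 : f (Function.update Φ i cl) ≤ f Φ + 1 := by
      simp only [hfdef]
      have h := bst_satcount_update (Function.update Φ i cl) i (Φ i) (g (Function.update Φ i cl))
      rw [Function.update_idem, Function.update_eq_self] at h
      exact_mod_cast h.trans (Nat.add_le_add_right (hg Φ (g (Function.update Φ i cl))) 1)
    have habs : |f Φ - f (Function.update Φ i cl)| ≤ 1 := abs_le.2 ⟨by linarith, by linarith⟩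
    exact (sq_le_one_iff_abs_le_one _).2 habs
  rcases isEmpty_or_nonempty (Fin k → Fin n × Bool) with hE | hNE
  · -- no clauses at all (`k > 0`, `n = 0`): with `m ≥ 1` there are no instances either
    haveI : IsEmpty (Fin m → Fin k → Fin n × Bool) := ⟨fun Φ => hE.elim (Φ ⟨0, hmpos⟩)⟩
    simp [Finset.univ_eq_empty]
    positivity
  haveI := hNE
  have hES := es_efronStein m f
  have hcardC : (0 : ℝ) < Fintype.card (Fin k → Fin n × Bool) := by exact_mod_cast Fintype.card_pos
  have hvar : ∑ Φ, (f Φ - μ) ^ 2 ≤ m * N / 2 := by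
    have hrhs : ∑ i : Fin m, ∑ Φ : Fin m → Fin k → Fin n × Bool, ∑ cl : Fin k → Fin n × Bool,
        (f Φ - f (Function.update Φ i cl)) ^ 2 ≤ m * (N * Fintype.card (Fin k → Fin n × Bool)) := by
      calc _ ≤ ∑ i : Fin m, ∑ Φ : Fin m → Fin k → Fin n × Bool, ∑ cl : Fin k → Fin n × Bool, (1 : ℝ) :=
            Finset.sum_le_sum fun i _ => Finset.sum_le_sum fun Φ _ => Finset.sum_le_sum fun cl _ => hbd Φ i cl
        _ = m * (N * Fintype.card (Fin k → Fin n × Bool)) := by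
            simp only [Finset.sum_const, Finset.card_univ, nsmul_eq_mul, mul_one, Fintype.card_fin, hNdef]
    rw [hμdef, hNdef] at *
    have h := hES
    rw [le_div_iff₀ (by norm_num : (0 : ℝ) < 2)]
    nlinarith [h, hrhs, hcardC]
  have hN0 : 0 < N := by rw [hNdef]; exact_mod_cast Fintype.card_pos
  -- satisfiable instances have `f = m`; every instance has `f ≤ m`
  have hfle : ∀ Φ, f Φ ≤ m := fun Φ => by simp only [hfdef]; exact_mod_cast bst_satcount_le Φ (g Φ)
  have hfsat : ∀ Φ : Fin m → Fin k → Fin n × Bool, (∃ σ : Fin n → Bool, ∀ i, ∃ j, σ (Φ i j).1 = (Φ i j).2) →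
      f Φ = m := by
    rintro Φ ⟨σ, hσ⟩
    refine le_antisymm (hfle Φ) ?_
    simp only [hfdef]
    have hall : ((univ : Finset (Fin m)).filter fun i => ∃ j, σ (Φ i j).1 = (Φ i j).2).card = m := by
      rw [Finset.filter_true_of_mem fun i _ => hσ i, Finset.card_univ, Fintype.card_fin]
    have := hg Φ σ
    rw [hall] at this
    exact_mod_cast this
  -- the mean is at most `m` and close to `m`: `(m - μ)² ≤ m/(2ε) ≤ (ν m/2)²`
  have hμle : μ ≤ m := by
    rw [hμdef, div_le_iff₀ hN0]
    calc ∑ Φ, f Φ ≤ ∑ Φ : Fin m → Fin k → Fin n × Bool, (m : ℝ) := Finset.sum_le_sum fun Φ _ => hfle Φ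
      _ = m * N := by rw [Finset.sum_const, Finset.card_univ, nsmul_eq_mul, hNdef, mul_comm]
  have hdev : ε * N * ((m : ℝ) - μ) ^ 2 ≤ m * N / 2 := by
    set Ssat := (univ : Finset (Fin m → Fin k → Fin n × Bool)).filter fun Φ =>
      ∃ σ : Fin n → Bool, ∀ i, ∃ j, σ (Φ i j).1 = (Φ i j).2 with hSsat
    calc ε * N * ((m : ℝ) - μ) ^ 2 ≤ (Ssat.card : ℝ) * ((m : ℝ) - μ) ^ 2 :=
          mul_le_mul_of_nonneg_right hsat (sq_nonneg _)
      _ = ∑ Φ ∈ Ssat, (f Φ - μ) ^ 2 := by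
          rw [Finset.sum_congr rfl fun Φ hΦ => by rw [hfsat Φ (Finset.mem_filter.1 hΦ).2], Finset.sum_const,
            nsmul_eq_mul]
      _ ≤ ∑ Φ, (f Φ - μ) ^ 2 := Finset.sum_le_univ_sum_of_nonneg fun Φ => sq_nonneg _
      _ ≤ m * N / 2 := hvar
  have hdev' : ((m : ℝ) - μ) ^ 2 ≤ (ν * m / 2) ^ 2 := by
    have h1 : ((m : ℝ) - μ) ^ 2 ≤ m / (2 * ε) := by
      rw [le_div_iff₀ (by positivity)]; nlinarith [hdev, hN0]
    have h2 : (m : ℝ) / (2 * ε) ≤ (ν * m / 2) ^ 2 := by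
      have hm' : 2 ≤ ε * ν ^ 2 * m := by
        have := (div_le_iff₀ (by positivity : (0 : ℝ) < ε * ν ^ 2)).1 hm
        linarith
      rw [div_le_iff₀ (by positivity)]
      nlinarith [hm', hmR.le]
    exact h1.trans h2
  have hmμ : (m : ℝ) - μ ≤ ν * m / 2 :=
    (pow_le_pow_iff_left₀ (by linarith : (0 : ℝ) ≤ m - μ) (by positivity : (0 : ℝ) ≤ ν * m / 2)
      (by norm_num : (2 : ℕ) ≠ 0)).1 hdev'
  -- bad instances deviate by more than `ν m / 2`
  set B := (univ : Finset (Fin m → Fin k → Fin n × Bool)).filter fun Φ =>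
    ¬ ((((univ : Finset (Fin m)).filter fun i => ∀ j, g Φ (Φ i j).1 ≠ (Φ i j).2).card : ℝ) ≤ ν * m) with hB
  have hbad : ∀ Φ ∈ B, (ν * m / 2) ^ 2 ≤ (f Φ - μ) ^ 2 := by
    intro Φ hΦ
    have hviol : ν * m < (((univ : Finset (Fin m)).filter fun i => ∀ j, g Φ (Φ i j).1 ≠ (Φ i j).2).card : ℝ) :=
      not_le.1 (Finset.mem_filter.1 hΦ).2
    have hcompl : ((((univ : Finset (Fin m)).filter fun i => ∀ j, g Φ (Φ i j).1 ≠ (Φ i j).2).card : ℝ))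
        = m - f Φ := by
      have h := Finset.card_filter_add_card_filter_not (s := (univ : Finset (Fin m)))
        (fun i => ∃ j, g Φ (Φ i j).1 = (Φ i j).2)
      rw [Finset.card_univ, Fintype.card_fin] at h
      have hneg : ((univ : Finset (Fin m)).filter fun i => ¬ ∃ j, g Φ (Φ i j).1 = (Φ i j).2)
          = (univ.filter fun i => ∀ j, g Φ (Φ i j).1 ≠ (Φ i j).2) := by
        congr 1; ext i; simp
      rw [hneg] at h
      simp only [hfdef]
      have h' : ((((univ : Finset (Fin m)).filter fun i => ∃ j, g Φ (Φ i j).1 = (Φ i j).2).card : ℕ) : ℝ)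
          + (((univ : Finset (Fin m)).filter fun i => ∀ j, g Φ (Φ i j).1 ≠ (Φ i j).2).card : ℕ) = m := by
        exact_mod_cast h
      linarith
    rw [hcompl] at hviol
    have hge : ν * m / 2 ≤ μ - f Φ := by linarith
    have h0 : 0 ≤ ν * m / 2 := by positivity
    calc (ν * m / 2) ^ 2 ≤ (μ - f Φ) ^ 2 := pow_le_pow_left₀ h0 hge 2
      _ = (f Φ - μ) ^ 2 := by ring
  -- Chebyshev, counting form
  have hcheb : (ν * m / 2) ^ 2 * (B.card : ℝ) ≤ m * N / 2 := by
    calc (ν * m / 2) ^ 2 * (B.card : ℝ) = ∑ Φ ∈ B, (ν * m / 2) ^ 2 := by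
          rw [Finset.sum_const, nsmul_eq_mul, mul_comm]
      _ ≤ ∑ Φ ∈ B, (f Φ - μ) ^ 2 := Finset.sum_le_sum hbad
      _ ≤ ∑ Φ, (f Φ - μ) ^ 2 := Finset.sum_le_univ_sum_of_nonneg fun Φ => sq_nonneg _
      _ ≤ m * N / 2 := hvar
  -- conclude: `(k m) #B ≤ 2k/ν² · N`
  have hk0 : (0 : ℝ) ≤ k := Nat.cast_nonneg k
  have hB' : (m : ℝ) * (B.card : ℝ) ≤ 2 / ν ^ 2 * N := by
    rw [div_mul_eq_mul_div, le_div_iff₀ (by positivity)]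
    have : ν ^ 2 * m ^ 2 / 4 * (B.card : ℝ) ≤ m * N / 2 := by
      calc ν ^ 2 * m ^ 2 / 4 * (B.card : ℝ) = (ν * m / 2) ^ 2 * (B.card : ℝ) := by ring
        _ ≤ m * N / 2 := hcheb
    nlinarith [this, hmR]
  push_cast
  calc (k : ℝ) * m * (B.card : ℝ) = k * (m * (B.card : ℝ)) := by ring
    _ ≤ k * (2 / ν ^ 2 * N) := mul_le_mul_of_nonneg_left hB' hk0
    _ = 2 * k / ν ^ 2 * N := by ring

end Summit.PneNP.PneNP.Cruxes.SolvableImpliesStableSection.Sketch
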